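import Summits.MatrixMultiplication.MatrixMultiplication.Theorems.ObstructionDescentLeviWeylLaw

set_option linter.dupNamespace false

/-!
# Separate-degree secant vanishing — the Strassen mechanism behind the cube and pair laws (decomp-mm · lens 3 · gen 15, part H)

Route `route-MatrixMultiplication-ObstructionDescent`, support for the aside `InvariantSaturation` (item
`stmt-MatrixMultiplication-32282`).  Kernel of the common core of the hand laws H18 (cube law) and H19 (pair law)
of NODE-g15 §1: a vanishing mechanism for weight vectors on secant varieties that uses NO determinant, NO
flattening and NO evaluation — only homogeneity, `GL_m³`-covariance and a bound on the degree of `f` along ONE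
coordinate direction.

* **§1 Separate-degree vanishing (pure algebra, `eq_zero_of_isHomogeneous_of_degreeOf_le`,
  `degreeOf_le_of_lineDegree`).**  A homogeneous polynomial `Φ` of degree `D` in finitely many variables whose degree
  in each single variable is `≤ δ` is `0` as soon as `δ · #variables < D` (every monomial has total degree `D` but at
  most `δ` in each variable); and `degreeOf i Φ ≤ δ` holds as soon as through EVERY point the restriction of `Φ` to the
  `i`-th coordinate line is a one-variable polynomial of degree `≤ δ` (leading coefficient in the remaining variables
  is a non-zero polynomial, hence non-zero somewhere — `MvPolynomial.funext` over the infinite field).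
* **§2 Secant form (`evalT_sum_eq_zero_of_lineDegree`).**  If `f ∈ ℂ[ℂ^m ⊗ ℂ^m ⊗ ℂ^m]` is homogeneous of degree `D`
  and for tensors `t₁, …, t_r` the function `u ↦ f(y + u·t_i)` is a polynomial of degree `≤ δ` for EVERY `y` and every
  `i`, then `f(t₁ + ⋯ + t_r) = 0` whenever `δ·r < D`: apply §1 to `Φ(λ) := f(Σ_i λ_i t_i) ∈ ℂ[λ₁,…,λ_r]`
  (`secant_isHomogeneous`, `eval_secant`), which is homogeneous of degree `D` (`MvPolynomial.IsHomogeneous.aeval` with linear forms).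
* **§3 From one coordinate to every rank-one direction (`evalT_eq_zero_of_coordDegree`).**  A weight vector `f` of a
  type `Λ` that is CONSTANT in every slot (the full-format rectangular types `((k^m))³` of the level vectors) is
  `GL_m³`-semi-invariant: `f((A,B,C)·t) = χ(A,B,C)·f(t)` with `χ ≠ 0` (`exists_evalT_actTensor_eq_mul`; Borel
  eigenvector + root-group invariance `evalT_slotAct_transvection` + `Matrix.diagonal_transvection_induction_of_det_ne_zero`).
  Every non-zero triad `u ⊗ v ⊗ w` is `(A,B,C)·e_{abc}` with invertible `A, B, C` (`exists_actTensor_coord_eq_triad`),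
  so a degree bound `≤ δ` along the single coordinate direction `e_{abc}` at every point transports to every rank-one
  direction at every point (`lineDegree_actTensor`), and §2 gives: **`f` vanishes on every tensor of rank `≤ r`
  whenever `δ·r < deg f`.**  (Vanishing on the Zariski closure `σ_r` follows by continuity and is not restated.)
* READINGS (hand laws of NODE-g15, whose remaining step — the coordinate degree bound `δ = k − 1` from a DEAD unit
  window `(m−1,1)`, resp. the pair version from the vacuous `(m−2,2)` window — is the next kernel target):
  H18 CUBE LAW `f ∈ I(σ_r)` for `(k−1)·r < k·m` when the unit window is dead (Strassen's `F₃ ∈ I(σ₄(3³))` with no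
  determinant; `H₅ ∈ I(σ₇(5³))` from `c₄₁ = 0`, answering Q14.4; `K₈ ∈ I(σ₁₁(8³))` from `k₇(3) = 0`); H19 PAIR LAW
  `r_N(3) ≥ ⌈3N/2⌉ (N even), ⌈3N/2⌉ − 1 (N odd)` from `k₂(3) = 0` (so `r₆(3) = 9` exact with the census datum
  `c₅₁ = 36/5`, and `r₉(3) ≥ 13`).  Nearest print: Strassen's invariant of type `((3^m),(3^m),(m,m,m))` on
  `ℂ^m ⊗ ℂ^m ⊗ ℂ³` vanishing on `σ_r`, `r ≤ ⌈3m/2⌉ − 1`, by commutators [cite: BurgisserIkenmeyer2011, §6.2]; the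
  per-term chromatic-index bound for obstruction designs [cite: BurgisserIkenmeyer2013, Prop. 4.2].
[cite: BurgisserIkenmeyer2011, §3.1–3.2] (weight vectors as Borel eigenvectors), [cite: BurgisserIkenmeyer2017, §5 (5.2), Thm 5.3]
(level vectors), [cite: Grosshans1997, Cor. 3.6] (root-group invariance).
-/

open scoped BigOperators
open Finset

namespace Summit.MatrixMultiplication.MatrixMultiplication.Theorems.ObstructionCalculus

open Literature.Computability.AlgebraicComplexity (actTensor actTensor_apply actTensor_actTensor actTensor_one
  actTensor_zero actTensor_triad triad triad_apply tensorRank exists_eq_sum_triad_of_tensorRank_le)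

/-! ### §1 Separate-degree vanishing -/

section SeparateDegree

variable {K : Type*} [Field K] [Infinite K] {ι : Type*} [Fintype ι] [DecidableEq ι]

omit [Infinite K] [DecidableEq ι] in
/-- A homogeneous polynomial of degree `D` in finitely many variables whose degree in each single variable is `≤ δ`
vanishes identically once `δ · #variables < D`. [folklore] -/
theorem eq_zero_of_isHomogeneous_of_degreeOf_le {Φ : MvPolynomial ι K} {D δ : ℕ} (hΦ : Φ.IsHomogeneous D)
    (hdeg : ∀ i, Φ.degreeOf i ≤ δ) (hD : δ * Fintype.card ι < D) : Φ = 0 := by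
  by_contra hne
  obtain ⟨s, hs⟩ := MvPolynomial.ne_zero_iff.mp hne
  have hs' : s ∈ Φ.support := MvPolynomial.mem_support_iff.mpr hs
  have h1 : D = ∑ i ∈ s.support, s i := hΦ.degree_eq_sum_deg_support hs'
  have h2 : ∑ i ∈ s.support, s i ≤ ∑ i, s i := Finset.sum_le_sum_of_subset (Finset.subset_univ _)
  have h3 : ∑ i, s i ≤ ∑ _i : ι, δ :=
    Finset.sum_le_sum fun i _ => (MvPolynomial.monomial_le_degreeOf i hs').trans (hdeg i)
  rw [Finset.sum_const, Finset.card_univ, smul_eq_mul, mul_comm] at h3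
  omega

omit [Fintype ι] in
/-- If through EVERY point the restriction of `Φ` to the `i`-th coordinate line is a one-variable polynomial of degree
`≤ δ`, then `degreeOf i Φ ≤ δ`. [folklore] -/
theorem degreeOf_le_of_lineDegree {Φ : MvPolynomial ι K} {δ : ℕ} (i : ι)
    (h : ∀ c : ι → K, ∃ Q : Polynomial K, Q.natDegree ≤ δ ∧
      ∀ u : K, MvPolynomial.eval (Function.update c i u) Φ = Q.eval u) :
    Φ.degreeOf i ≤ δ := by
  rw [MvPolynomial.degreeOf_eq_natDegree i Φ]
  set P := MvPolynomial.optionEquivLeft K {b // b ≠ i}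
    (MvPolynomial.rename (Equiv.optionSubtypeNe i).symm Φ) with hP
  by_contra hlt
  have hlt' : δ < P.natDegree := not_le.mp hlt
  have hP0 : P ≠ 0 := by
    intro h0
    rw [h0, Polynomial.natDegree_zero] at hlt'
    exact Nat.not_lt_zero _ hlt'
  have hlc : P.coeff P.natDegree ≠ 0 := Polynomial.leadingCoeff_ne_zero.mpr hP0
  obtain ⟨s, hs⟩ : ∃ s : {b // b ≠ i} → K, MvPolynomial.eval s (P.coeff P.natDegree) ≠ 0 := by
    by_contra hall
    refine hlc (MvPolynomial.funext fun s => ?_)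
    rw [map_zero]
    by_contra hs
    exact hall ⟨s, hs⟩
  let c : ι → K := fun j => if hj : j = i then 0 else s ⟨j, hj⟩
  obtain ⟨Q, hQδ, hQ⟩ := h c
  have hPQ : P.map (MvPolynomial.eval s) = Q := by
    refine Polynomial.funext fun u => ?_
    rw [← hQ u, hP, ← MvPolynomial.optionEquivLeft_elim_eval, MvPolynomial.eval_rename]
    have hfun : ((fun x : Option {b // b ≠ i} => x.elim u s) ∘ (Equiv.optionSubtypeNe i).symm) =
        Function.update c i u := by
      funext j
      by_cases hj : j = i
      · subst hj
        simp
      · simp [Function.comp_apply, Equiv.optionSubtypeNe_symm_of_ne hj, c, hj]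
    rw [hfun]
  have h1 : (P.map (MvPolynomial.eval s)).coeff P.natDegree ≠ 0 := by
    rw [Polynomial.coeff_map]
    exact hs
  have h2 : P.natDegree ≤ (P.map (MvPolynomial.eval s)).natDegree := Polynomial.le_natDegree_of_ne_zero h1
  rw [hPQ] at h2
  omega

/-- **Separate-degree vanishing.**  A homogeneous polynomial of degree `D > δ · #variables` whose restriction to every
coordinate line through every point has degree `≤ δ` is zero. [folklore] -/
theorem eq_zero_of_isHomogeneous_of_lineDegree {Φ : MvPolynomial ι K} {D δ : ℕ} (hΦ : Φ.IsHomogeneous D)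
    (h : ∀ (i : ι) (c : ι → K), ∃ Q : Polynomial K, Q.natDegree ≤ δ ∧
      ∀ u : K, MvPolynomial.eval (Function.update c i u) Φ = Q.eval u)
    (hD : δ * Fintype.card ι < D) : Φ = 0 :=
  eq_zero_of_isHomogeneous_of_degreeOf_le hΦ (fun i => degreeOf_le_of_lineDegree i (h i)) hD

end SeparateDegree

/-! ### §2 The secant form -/

section Secant

variable {m : ℕ}

/-- `f(Σ_i λ_i t_i) ∈ ℂ[λ₁, …, λ_r]` — the pull-back of `f` along the linear substitution
`x_{abc} ↦ Σ_i (t_i)_{abc} · λ_i` — is homogeneous of the degree of `f`. [folklore] -/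
theorem secant_isHomogeneous {r D : ℕ} (t : Fin r → Tensor ℂ m) {f : MvPolynomial (Idx m) ℂ}
    (hf : f.IsHomogeneous D) :
    (MvPolynomial.aeval (fun p : Idx m => ∑ i : Fin r, MvPolynomial.C (t i p.1 p.2.1 p.2.2) * MvPolynomial.X i)
      f).IsHomogeneous D := by
  have h := hf.aeval (fun p : Idx m => ∑ i : Fin r, MvPolynomial.C (t i p.1 p.2.1 p.2.2) * MvPolynomial.X i)
    (n := 1) fun p => ?_
  · simpa only [one_mul] using h
  · exact MvPolynomial.IsHomogeneous.sum _ _ _ fun i _ => MvPolynomial.isHomogeneous_C_mul_X _ _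

/-- Evaluating `f(Σ_i λ_i t_i)` at `λ = c` gives `f(Σ_i c_i t_i)`. [bookkeeping] -/
theorem eval_secant {r : ℕ} (t : Fin r → Tensor ℂ m) (f : MvPolynomial (Idx m) ℂ) (c : Fin r → ℂ) :
    MvPolynomial.eval c (MvPolynomial.aeval
        (fun p : Idx m => ∑ i : Fin r, MvPolynomial.C (t i p.1 p.2.1 p.2.2) * MvPolynomial.X i) f) =
      evalT (∑ i, c i • t i) f := by
  rw [← MvPolynomial.coe_aeval_eq_eval, evalT]
  change ((MvPolynomial.aeval c).comp (MvPolynomial.aeval _)) f = _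
  rw [MvPolynomial.comp_aeval]
  have hfun : (fun p : Idx m => (MvPolynomial.aeval c)
      (∑ i : Fin r, MvPolynomial.C (t i p.1 p.2.1 p.2.2) * MvPolynomial.X i)) =
      fun p : Idx m => (∑ i, c i • t i) p.1 p.2.1 p.2.2 := by
    funext p
    simp only [map_sum, map_mul, MvPolynomial.aeval_C, MvPolynomial.aeval_X,
      Algebra.algebraMap_self_apply, Finset.sum_apply, Pi.smul_apply, smul_eq_mul]
    exact Finset.sum_congr rfl fun i _ => mul_comm _ _
  rw [hfun]

/-- **Secant vanishing from line degrees.**  If `f` is homogeneous of degree `D` and `u ↦ f(y + u·t_i)` is a polynomial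
of degree `≤ δ` for every tensor `y` and every `i`, then `f(t₁ + ⋯ + t_r) = 0` as soon as `δ·r < D`. [this node] -/
theorem evalT_sum_eq_zero_of_lineDegree {r D δ : ℕ} {f : MvPolynomial (Idx m) ℂ} (hf : f.IsHomogeneous D)
    (t : Fin r → Tensor ℂ m)
    (hline : ∀ (y : Tensor ℂ m) (i : Fin r), ∃ Q : Polynomial ℂ, Q.natDegree ≤ δ ∧
      ∀ u : ℂ, evalT (y + u • t i) f = Q.eval u)
    (hD : δ * r < D) : evalT (∑ i, t i) f = 0 := by
  have hΦ : MvPolynomial.aeval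
      (fun p : Idx m => ∑ i : Fin r, MvPolynomial.C (t i p.1 p.2.1 p.2.2) * MvPolynomial.X i) f = 0 := by
    refine eq_zero_of_isHomogeneous_of_lineDegree (secant_isHomogeneous t hf) (fun i c => ?_)
      (by simpa only [Fintype.card_fin] using hD)
    obtain ⟨Q, hQδ, hQ⟩ := hline (∑ j ∈ Finset.univ \ {i}, c j • t j) i
    refine ⟨Q, hQδ, fun u => ?_⟩
    rw [eval_secant, ← hQ u]
    have hfun : (fun j => Function.update c i u j • t j) = Function.update (fun j => c j • t j) i (u • t i) := by
      funext j
      by_cases hj : j = i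
      · subst hj
        simp
      · simp [Function.update_of_ne hj]
    rw [hfun, Finset.sum_update_of_mem (Finset.mem_univ i), add_comm]
  have h := eval_secant t f fun _ => 1
  rw [hΦ, map_zero] at h
  simpa only [one_smul] using h.symm

end Secant

/-! ### §3 From one coordinate direction to every rank-one direction -/

section Covariance

variable {m : ℕ}

/-- `(A,B,C)·(c • t) = c • (A,B,C)·t`. [bookkeeping] -/
theorem actTensor_smul' (A B C : Matrix (Fin m) (Fin m) ℂ) (c : ℂ) (t : Tensor ℂ m) :
    actTensor A B C (c • t) = c • actTensor A B C t := by
  funext x y z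
  simp only [actTensor_apply, Pi.smul_apply, smul_eq_mul, Finset.mul_sum]
  exact Finset.sum_congr rfl fun _ _ => Finset.sum_congr rfl fun _ _ => Finset.sum_congr rfl fun _ _ => by ring

/-- A triple action is the composite of its three one-slot actions. [bookkeeping] -/
theorem actTensor_eq_slotAct (A B C : Matrix (Fin m) (Fin m) ℂ) (t : Tensor ℂ m) :
    actTensor A B C t = slotAct 0 A (slotAct 1 B (slotAct 2 C t)) := by
  simp only [slotAct_zero, slotAct_one, slotAct_two, actTensor_actTensor, Matrix.one_mul, Matrix.mul_one]

/-- **Full one-slot covariance.**  A weight vector whose weight in slot `s` is constant is semi-invariant under the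
whole `GL_m` of that slot: `f(X·_s t) = χ · f(t)` with `χ ≠ 0`. [cite: Grosshans1997, Cor. 3.6] -/
theorem exists_evalT_slotAct_eq_mul {Λ : Fin 3 → Fin m → ℕ} {d : ℕ} {f : MvPolynomial (Idx m) ℂ}
    (hf : f ∈ hwvSpace Λ d) (s : Fin 3) (hΛ : ∀ i j : Fin m, Λ s i = Λ s j) {X : Matrix (Fin m) (Fin m) ℂ}
    (hX : X.det ≠ 0) : ∃ χ : ℂ, χ ≠ 0 ∧ ∀ t : Tensor ℂ m, evalT (slotAct s X t) f = χ * evalT t f := by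
  refine Matrix.diagonal_transvection_induction_of_det_ne_zero
    (fun Y => ∃ χ : ℂ, χ ≠ 0 ∧ ∀ t : Tensor ℂ m, evalT (slotAct s Y t) f = χ * evalT t f) X hX
    (fun D hD => ?_) (fun τ => ⟨1, one_ne_zero, fun t => ?_⟩) (fun Y Z _ _ hY hZ => ?_)
  · have hD' : ∀ i, D i ≠ 0 := fun i hi => hD (by
      rw [Matrix.det_diagonal]
      exact Finset.prod_eq_zero (Finset.mem_univ i) hi)
    exact ⟨weightChar (Λ s) (Matrix.diagonal D), weightChar_ne_zero _ (diagonal_mem_borel hD'),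
      fun t => evalT_slotAct hf (diagonal_mem_borel hD') t s⟩
  · rw [one_mul, Matrix.TransvectionStruct.toMatrix]
    exact evalT_slotAct_transvection hf s τ.hij (hΛ τ.i τ.j) τ.c t
  · obtain ⟨χ₁, h₁, h₁'⟩ := hY
    obtain ⟨χ₂, h₂, h₂'⟩ := hZ
    refine ⟨χ₁ * χ₂, mul_ne_zero h₁ h₂, fun t => ?_⟩
    rw [← slotAct_mul, h₁', h₂', mul_assoc]

/-- **Full covariance.**  A weight vector of a slotwise-constant type (e.g. the full-format rectangular type
`((k^m))³`) is `GL_m³`-semi-invariant: `f((A,B,C)·t) = χ(A,B,C)·f(t)`, `χ ≠ 0`. [cite: Grosshans1997, Cor. 3.6] -/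
theorem exists_evalT_actTensor_eq_mul {Λ : Fin 3 → Fin m → ℕ} {d : ℕ} {f : MvPolynomial (Idx m) ℂ}
    (hf : f ∈ hwvSpace Λ d) (hΛ : ∀ (s : Fin 3) (i j : Fin m), Λ s i = Λ s j)
    {A B C : Matrix (Fin m) (Fin m) ℂ} (hA : A.det ≠ 0) (hB : B.det ≠ 0) (hC : C.det ≠ 0) :
    ∃ χ : ℂ, χ ≠ 0 ∧ ∀ t : Tensor ℂ m, evalT (actTensor A B C t) f = χ * evalT t f := by
  obtain ⟨χ₀, h₀, h₀'⟩ := exists_evalT_slotAct_eq_mul hf 0 (hΛ 0) hA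
  obtain ⟨χ₁, h₁, h₁'⟩ := exists_evalT_slotAct_eq_mul hf 1 (hΛ 1) hB
  obtain ⟨χ₂, h₂, h₂'⟩ := exists_evalT_slotAct_eq_mul hf 2 (hΛ 2) hC
  refine ⟨χ₀ * χ₁ * χ₂, mul_ne_zero (mul_ne_zero h₀ h₁) h₂, fun t => ?_⟩
  rw [actTensor_eq_slotAct, h₀', h₁', h₂']
  ring

/-- Transport of a line-degree bound along the group: if `f((A,B,C)·t) = χ f(t)` for invertible `A, B, C` and
`u ↦ f(y + u·v)` has degree `≤ δ` for every `y`, then so does `u ↦ f(y + u·(A,B,C)·v)`. [this node] -/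
theorem lineDegree_actTensor {f : MvPolynomial (Idx m) ℂ} {δ : ℕ} {A B C : Matrix (Fin m) (Fin m) ℂ}
    (hA : A.det ≠ 0) (hB : B.det ≠ 0) (hC : C.det ≠ 0) {χ : ℂ}
    (hχ : ∀ t : Tensor ℂ m, evalT (actTensor A B C t) f = χ * evalT t f) {v : Tensor ℂ m}
    (hdeg : ∀ y : Tensor ℂ m, ∃ Q : Polynomial ℂ, Q.natDegree ≤ δ ∧ ∀ u : ℂ, evalT (y + u • v) f = Q.eval u)
    (y : Tensor ℂ m) :
    ∃ Q : Polynomial ℂ, Q.natDegree ≤ δ ∧ ∀ u : ℂ, evalT (y + u • actTensor A B C v) f = Q.eval u := by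
  obtain ⟨Q, hQδ, hQ⟩ := hdeg (actTensor A⁻¹ B⁻¹ C⁻¹ y)
  refine ⟨Polynomial.C χ * Q, (Polynomial.natDegree_C_mul_le χ Q).trans hQδ, fun u => ?_⟩
  have hy : y = actTensor A B C (actTensor A⁻¹ B⁻¹ C⁻¹ y) := by
    rw [actTensor_actTensor, Matrix.mul_nonsing_inv A (isUnit_iff_ne_zero.mpr hA),
      Matrix.mul_nonsing_inv B (isUnit_iff_ne_zero.mpr hB), Matrix.mul_nonsing_inv C (isUnit_iff_ne_zero.mpr hC),
      actTensor_one]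
  rw [Polynomial.eval_mul, Polynomial.eval_C, ← hQ u, ← hχ, actTensor_add', actTensor_smul', ← hy]

/-- An invertible matrix with a prescribed non-zero column: `A e_a = u`. [folklore] -/
theorem exists_det_ne_zero_mulVec_single {u : Fin m → ℂ} (hu : u ≠ 0) (a : Fin m) :
    ∃ A : Matrix (Fin m) (Fin m) ℂ, A.det ≠ 0 ∧ A.mulVec (Pi.single a 1) = u := by
  obtain ⟨j, hj⟩ : ∃ j, u j ≠ 0 := by
    by_contra h
    exact hu (funext fun j => by
      by_contra hj
      exact h ⟨j, hj⟩)
  set M : Matrix (Fin m) (Fin m) ℂ := (1 : Matrix (Fin m) (Fin m) ℂ).updateCol j u with hM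
  have hMdet : M.det = u j := by
    have h := Matrix.det_updateCol_sum (1 : Matrix (Fin m) (Fin m) ℂ) j u
    rw [Matrix.det_one, smul_eq_mul, mul_one] at h
    rw [hM, ← h]
    congr 1
    funext k
    simp [Matrix.one_apply]
  refine ⟨M * (Equiv.swap a j).permMatrix ℂ, ?_, ?_⟩
  · rw [Matrix.det_mul, hMdet, Matrix.det_permutation]
    refine mul_ne_zero hj ?_
    rcases Int.units_eq_one_or (Equiv.Perm.sign (Equiv.swap a j)) with h | h <;> simp [h]
  · rw [← Matrix.mulVec_mulVec, Matrix.permMatrix_mulVec]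
    have hsw : (Pi.single a (1 : ℂ)) ∘ (Equiv.swap a j) = Pi.single j 1 := by
      funext i
      simp only [Function.comp_apply, Pi.single_apply]
      by_cases hi : i = j
      · subst hi
        simp
      · rw [if_neg hi, Equiv.swap_apply_def]
        by_cases hia : i = a
        · subst hia
          simp [Ne.symm hi]
        · simp [hia, hi]
    rw [hsw, Matrix.mulVec_single_one]
    funext i
    simp [hM, Matrix.updateCol_self]

/-- Every non-zero triad is a `GL_m³`-translate of any coordinate tensor
`e_{abc} = e_a ⊗ e_b ⊗ e_c` (`triad (Pi.single a 1) (Pi.single b 1) (Pi.single c 1)`): `u ⊗ v ⊗ w = (A,B,C)·e_{abc}`.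
[folklore] -/
theorem exists_actTensor_coord_eq_triad {u v w : Fin m → ℂ} (hu : u ≠ 0) (hv : v ≠ 0) (hw : w ≠ 0)
    (a b c : Fin m) : ∃ A B C : Matrix (Fin m) (Fin m) ℂ, A.det ≠ 0 ∧ B.det ≠ 0 ∧ C.det ≠ 0 ∧
      actTensor A B C (triad (Pi.single a 1) (Pi.single b 1) (Pi.single c 1)) = triad u v w := by
  obtain ⟨A, hA, hAu⟩ := exists_det_ne_zero_mulVec_single hu a
  obtain ⟨B, hB, hBv⟩ := exists_det_ne_zero_mulVec_single hv b
  obtain ⟨C, hC, hCw⟩ := exists_det_ne_zero_mulVec_single hw c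
  exact ⟨A, B, C, hA, hB, hC, by rw [actTensor_triad, hAu, hBv, hCw]⟩

/-- A triad with a zero factor is zero. [bookkeeping] -/
theorem triad_eq_zero_of_factor {u v w : Fin m → ℂ} (h : u = 0 ∨ v = 0 ∨ w = 0) :
    (triad u v w : Tensor ℂ m) = 0 := by
  funext a b c
  rw [triad_apply]
  rcases h with h | h | h <;> simp [h]

/-- **Secant vanishing from ONE coordinate degree bound (the Strassen mechanism).**  Let `f` be a weight vector of
a slotwise-constant type `Λ` in degree `D` (e.g. a full-format level vector, type `((k^m))³`, `D = km`) such that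
along ONE coordinate direction `e_{abc}` and through EVERY point `y` the polynomial `u ↦ f(y + u·e_{abc})` has degree
`≤ δ`.  Then `f` vanishes at every tensor of rank `≤ r` whenever `δ·r < D`. [this node] -/
theorem evalT_eq_zero_of_coordDegree {Λ : Fin 3 → Fin m → ℕ} {D δ : ℕ} {f : MvPolynomial (Idx m) ℂ}
    (hf : f ∈ hwvSpace Λ D) (hΛ : ∀ (s : Fin 3) (i j : Fin m), Λ s i = Λ s j) {a b c : Fin m}
    (hdeg : ∀ y : Tensor ℂ m, ∃ Q : Polynomial ℂ, Q.natDegree ≤ δ ∧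
      ∀ u : ℂ, evalT (y + u • triad (Pi.single a 1) (Pi.single b 1) (Pi.single c 1)) f = Q.eval u)
    {r : ℕ} (hr : δ * r < D) {t : Tensor ℂ m} (ht : tensorRank t ≤ r) : evalT t f = 0 := by
  obtain ⟨w, u, v, rfl⟩ := exists_eq_sum_triad_of_tensorRank_le ht
  refine evalT_sum_eq_zero_of_lineDegree hf.1 (fun i => triad (w i) (u i) (v i)) (fun y i => ?_) hr
  by_cases h0 : w i = 0 ∨ u i = 0 ∨ v i = 0
  · refine ⟨Polynomial.C (evalT y f), (Polynomial.natDegree_C _).le.trans (Nat.zero_le _), fun s => ?_⟩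
    rw [triad_eq_zero_of_factor h0, smul_zero, add_zero, Polynomial.eval_C]
  · have h0' : w i ≠ 0 ∧ u i ≠ 0 ∧ v i ≠ 0 := by
      refine ⟨fun h => h0 (Or.inl h), fun h => h0 (Or.inr (Or.inl h)), fun h => h0 (Or.inr (Or.inr h))⟩
    obtain ⟨A, B, C, hA, hB, hC, hABC⟩ := exists_actTensor_coord_eq_triad h0'.1 h0'.2.1 h0'.2.2 a b c
    obtain ⟨χ, -, hχ⟩ := exists_evalT_actTensor_eq_mul hf hΛ hA hB hC
    rw [← hABC]
    exact lineDegree_actTensor hA hB hC hχ hdeg y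

/-- The full-format rectangular type `((k^m))³` is slotwise constant. [bookkeeping] -/
theorem rectType_self_const (k : ℕ) (s : Fin 3) (i j : Fin m) : rectType m m k s i = rectType m m k s j := by
  simp only [rectType, if_pos (Nat.le_add_left m i), if_pos (Nat.le_add_left m j)]

/-- **Corollary (full-format level vectors).**  A level-`k` vector of the full format `m` (type `((k^m))³`, degree
`k·m`) whose degree along one coordinate direction is `≤ δ` at every point vanishes on all tensors of rank `≤ r`
with `δ·r < k·m`; with `δ = k − 1` (cube law, dead unit window) this is `r < km/(k−1)`. [this node] -/
theorem evalT_eq_zero_of_coordDegree_level {k δ : ℕ} {f : MvPolynomial (Idx m) ℂ}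
    (hf : f ∈ hwvSpace (rectType m m k) (k * m)) {a b c : Fin m}
    (hdeg : ∀ y : Tensor ℂ m, ∃ Q : Polynomial ℂ, Q.natDegree ≤ δ ∧
      ∀ u : ℂ, evalT (y + u • triad (Pi.single a 1) (Pi.single b 1) (Pi.single c 1)) f = Q.eval u)
    {r : ℕ} (hr : δ * r < k * m) {t : Tensor ℂ m} (ht : tensorRank t ≤ r) : evalT t f = 0 :=
  evalT_eq_zero_of_coordDegree hf (fun s i j => rectType_self_const k s i j) hdeg hr ht

end Covariance

end Summit.MatrixMultiplication.MatrixMultiplication.Theorems.ObstructionCalculus
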